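import Summits.ValiantsHypothesis.ValiantsHypothesis.Theses.DivisionGap

/-!
# Crux `DivisionGap.ZeroOneTransfer` (stmt-ValiantsHypothesis-5066), line `charged-uncharged` —
# stub `cofactorCharging_of_monotoneKaltofen`

**Theorem (`cofactorCharging_of_monotoneKaltofen`).** The clean, VP-free and 0/1-free charging
statement "monotone Kaltofen" (MK):

> there is `k` such that for every finite variable type `τ`, every `f` and every nonzero `h` in
> `ℝ≥0[τ]` there is a nonzero `h'` with
> `L₊(f h') + L₊(h') ≤ 2 ^ ((log₂ #τ + log₂ L₊(f h) + k) ^ k)`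

implies the filed child **CofactorCharging** (CC) of the charged/uncharged split: for every
0/1-coefficient family `(f_n)` over `ℝ≥0` whose complexification is in `VP_ℂ` there is `K` with,
for all `n` and all nonzero `h`, a nonzero `h'` such that
`L₊(f_n h') + L₊(h') ≤ 2 ^ ((log₂ n + log₂ L₊(f_n h) + K) ^ K)`.
Here `L₊ = complexity` is the least size of a fan-in-two arithmetic circuit over the semiring `ℝ≥0`.

## Proof

From the `VP` hypothesis, the number of variables is p-bounded: `#(σ n) ≤ n ^ e + e` for some `e`
(`IsVPFamily = IsPFamily ∧ IsPComputable`, `IsPFamily = IsPBounded #σ ∧ IsPBounded deg`; the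
mapped family has the same variable types `σ n`).  Take `k` from MK and answer
`K := 3 (e + 1) (k + 1)`.  Given `n` and `h ≠ 0`, apply MK at `τ := σ n` to get `h'`; it remains
to compare exponents.  Since `n ^ e + e ≤ 2 ^ ((e + 1) (log₂ n + 1) + e)` we get
`log₂ #(σ n) ≤ (e + 1) (log₂ n + 1) + e`, whence
`log₂ #(σ n) + L + k ≤ (e + 1) a + L + K ≤ (a + L + K) (e + 1) ≤ (a + L + K) ²`
(`a = log₂ n`, `L = log₂ L₊(f_n h)`), and finally
`(log₂ #(σ n) + L + k) ^ k ≤ (a + L + K) ^ (2 k) ≤ (a + L + K) ^ K` (the base is `≥ K ≥ 1`).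
The 0/1 hypothesis is not used. [folklore]
-/

noncomputable section

-- Sub = Summit single-conjunct layout: the duplicated namespace component is mandated by the tree.
set_option linter.dupNamespace false

namespace Summit.ValiantsHypothesis.ValiantsHypothesis.Theorems.DivisionGapZeroOneTransfer

open Literature.Computability.AlgebraicComplexity
open scoped NNReal

namespace MonotoneKaltofen

/-- Variable-count absorption: if `c ≤ n ^ e + e` then `log₂ c ≤ (e + 1) (log₂ n + 1) + e`.
[folklore] -/
theorem log_card_le {c n e : ℕ} (hc : c ≤ n ^ e + e) :
    Nat.log 2 c ≤ (e + 1) * (Nat.log 2 n + 1) + e := by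
  have h2 : n ^ e + e ≤ 2 ^ ((e + 1) * (Nat.log 2 n + 1) + e) := by
    have hn : n ≤ 2 ^ (Nat.log 2 n + 1) := (Nat.lt_pow_succ_log_self Nat.one_lt_two n).le
    have hne : n ^ e ≤ 2 ^ (e * (Nat.log 2 n + 1)) := by
      rw [pow_mul']; exact Nat.pow_le_pow_left hn e
    have hee : e ≤ 2 ^ e := Nat.lt_two_pow_self.le
    calc n ^ e + e ≤ 2 ^ (e * (Nat.log 2 n + 1)) + 2 ^ e := Nat.add_le_add hne hee
      _ ≤ 2 ^ (e * (Nat.log 2 n + 1)) * 2 ^ e + 2 ^ (e * (Nat.log 2 n + 1)) * 2 ^ e := by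
          apply Nat.add_le_add
          · exact Nat.le_mul_of_pos_right _ (Nat.two_pow_pos e)
          · exact Nat.le_mul_of_pos_left _ (Nat.two_pow_pos _)
      _ = 2 ^ (e * (Nat.log 2 n + 1) + e + 1) := by rw [← pow_add]; ring
      _ ≤ 2 ^ ((e + 1) * (Nat.log 2 n + 1) + e) :=
          Nat.pow_le_pow_right Nat.two_pos (by nlinarith)
  have := Nat.log_mono_right (b := 2) (hc.trans h2)
  rwa [Nat.log_pow Nat.one_lt_two] at this

/-- Exponent absorption: with `K = 3 (e + 1) (k + 1)` and `v ≤ (e + 1) (a + 1) + e`,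
`(v + L + k) ^ k ≤ (a + L + K) ^ K`. [folklore] -/
theorem exponent_le {v a L e k : ℕ} (hv : v ≤ (e + 1) * (a + 1) + e) :
    (v + L + k) ^ k ≤ (a + L + 3 * (e + 1) * (k + 1)) ^ (3 * (e + 1) * (k + 1)) := by
  set K := 3 * (e + 1) * (k + 1) with hK
  have hK1 : 2 * e + 1 + k ≤ K := by rw [hK]; nlinarith
  have hK3 : 2 * k ≤ K := by rw [hK]; nlinarith
  have hbase : v + L + k ≤ (a + L + K) * (e + 1) := by
    have h1 : v + L + k ≤ (e + 1) * a + L + K := by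
      calc v + L + k ≤ (e + 1) * (a + 1) + e + L + k := by omega
        _ = (e + 1) * a + L + (2 * e + 1 + k) := by ring
        _ ≤ (e + 1) * a + L + K := by omega
    have h2 : (e + 1) * a + L + K ≤ (a + L + K) * (e + 1) := by nlinarith
    exact h1.trans h2
  have hsq : (a + L + K) * (e + 1) ≤ (a + L + K) * (a + L + K) :=
    Nat.mul_le_mul_left _ (by omega)
  calc (v + L + k) ^ k
      ≤ ((a + L + K) * (a + L + K)) ^ k := Nat.pow_le_pow_left (hbase.trans hsq) k
    _ = (a + L + K) ^ (2 * k) := by rw [← sq, ← pow_mul, Nat.mul_comm]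
    _ ≤ (a + L + K) ^ K := Nat.pow_le_pow_right (by omega) hK3

end MonotoneKaltofen

/-- **Monotone Kaltofen implies cofactor charging.** The clean (VP-free, 0/1-free) charging
statement — uniformly quasi-polynomial in the number of variables and in `L₊(f h)` — implies the
filed child `CofactorCharging` of the charged/uncharged split of `ZeroOneTransfer`: the `VP`
hypothesis bounds `#(σ n) ≤ n ^ e + e`, and `log₂ (n ^ e + e)` is absorbed into the constant
`K = 3 (e + 1) (k + 1)`. The 0/1 hypothesis is not used. [folklore] -/
theorem cofactorCharging_of_monotoneKaltofen :
    (∃ k : ℕ, ∀ (τ : Type) [Fintype τ] (f h : MvPolynomial τ NNReal), h ≠ 0 → ∃ h' : MvPolynomial τ NNReal, h' ≠ 0 ∧ Literature.Computability.AlgebraicComplexity.complexity (f * h') + Literature.Computability.AlgebraicComplexity.complexity h' ≤ 2 ^ ((Nat.log 2 (Fintype.card τ) + Nat.log 2 (Literature.Computability.AlgebraicComplexity.complexity (f * h)) + k) ^ k)) → ∀ (σ : ℕ → Type) [∀ n, Fintype (σ n)] (f : ∀ n, MvPolynomial (σ n) NNReal), (∀ n m, MvPolynomial.coeff m (f n)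 = 0 ∨ MvPolynomial.coeff m (f n) = 1) → Literature.Computability.AlgebraicComplexity.IsVPFamily (k := ℂ) (fun n => MvPolynomial.map (Complex.ofRealHom.comp NNReal.toRealHom) (f n)) → ∃ k : ℕ, ∀ n, ∀ h : MvPolynomial (σ n) NNReal, h ≠ 0 → ∃ h' : MvPolynomial (σ n) NNReal, h' ≠ 0 ∧ Literature.Computability.AlgebraicComplexity.complexity (f n * h') + Literature.Computability.AlgebraicComplexity.complexity h' ≤ 2 ^ ((Nat.log 2 n + Nat.log 2 (Literature.Computability.AlgebraicComplexity.complexity (f n * h)) + k) ^ k) := by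
  intro H σ _ f _ hVP
  obtain ⟨k, hk⟩ := H
  obtain ⟨e, he⟩ := hVP.1.1
  refine ⟨3 * (e + 1) * (k + 1), fun n h hh => ?_⟩
  obtain ⟨h', hh', hle⟩ := hk (σ n) (f n) h hh
  refine ⟨h', hh', hle.trans (Nat.pow_le_pow_right Nat.two_pos ?_)⟩
  exact MonotoneKaltofen.exponent_le (MonotoneKaltofen.log_card_le (he n))

end Summit.ValiantsHypothesis.ValiantsHypothesis.Theorems.DivisionGapZeroOneTransfer
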